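/-
Copyright (c) 2026 the pub-hodgecm-mathlib formalisation cell (harness21).  Prover seat hodgecm-mathlib-K2Liu-p05 (g3), 2026-09-04
(Track B «K2-LIT», crux hLiu418 = stmt-HodgeConjecture-24832, socket #42F′, ROAD I v3, organ G2-Weil, bridge (G2-W4) part W4-i (junction currency):
the archimedean section at one real place, read in Konno–Konno's junction frame `U(P′,Q′) × U(1,0)`, factorises through the junction Weil
representation — hence is `C^∞` along `U(2,2)` on product vectors).
-/
import Summits.HodgeConjecture.HodgeConjecture.Theorems.K2LiuArchSectionPlaceBlock          -- (W4-i frame half): `placeSec`, `hs`, `hW`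
import Summits.HodgeConjecture.HodgeConjecture.Theorems.K2LiuWeilDatumTwistSmoothU22        -- (W4b analytic half): `contDiffAt_of_tensorPi_factorisation`
import Literature.RepresentationTheory.KonnoKonno2007.JunctionWeilDatumGeneralRank            -- ★ `isArchWeilDatum_weilRepPair`, `weilRepPair_κ_hermitePi_zero`
import Literature.RepresentationTheory.KonnoKonno2007.RealUnitaryDualPairRelabel              -- ★ `Ginf.relabel`, `coe_reindexSp_sumCongr_of_eq_blockPhase`
import HarnessLib

/-!
# (G2-W4-i, junction currency) The archimedean section at one real place factorises through the junction Weil representation of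
# `U(P′,Q′) × U(1,0)`; hence Folland's section of the whole archimedean group is `C^∞` along `U(2,2)` on product vectors

Track B ∕ K2-LIT, hLiu418 = stmt-HodgeConjecture-24832, #42F′ ROAD I v3 organ G2-Weil, bridge (G2-W4) (LEAD F0P6-plan (g12) RULING M-156j (3)).
Namespace `Summit.HodgeConjecture.HodgeConjecture.Cruxes.HLiu418.K2LiuArchSectionPlaceBlock` (continued).  Definitions with body (`junctionMul`,
`placeSecJ`, `archSectionPhaseJ`, `archSectionRepJ` — compositions of ★ objects, in the style of ★ `HypCensus/ArchDatumBlockAt`) and proved theorems; no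
instance, no notation, no named fact, no `sorry`; the Mathlib idiom `attribute [local instance] LieRing.ofAssociativeRing` is inherited through the import of
★ `K2LiuWeilDatumTwistSmoothU22` only (not re-declared here).  `--supports stmt-HodgeConjecture-24832 --as helper`.

(W4-i frame half) ★∕📤 `K2LiuArchSectionPlaceBlock` proved: at a real place `σ`, Folland's section `s_∞ = archWeilSectionS` of ONE adelic unitary group
`U(J)`, `J = diag(t₀) ⊗ 1`, restricted along the one-place section `placeSec σ : U(P_σ,Q_σ) →* U(J)(F ⊗ ℝ)` and read in the split frame
`(P_σ ⊕ Q_σ) ⊕ (Fin N × {v ≠ σ})`, is a BLOCK PAIR.  The (G2-W2)∕(G2-W4b) engine of this series is typed in Konno–Konno's JUNCTION currency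
(`Ginf P′ Q′ R′ S′`, `ι𝕎`, `DPIdx`, `κ`, `vacScalar`); this file moves the block pair there, with `(R′, S′) = (1, ∅)` (the trivial junction partner of ★
`ArchUnitaryWeilHalf` §1) and literal block types `P′, Q′` along bijections `eP : PosIdx x_σ ≃ P′`, `eQ : NegIdx x_σ ≃ Q′`:

* §1 **`junctionMul P Q : Ginf P Q 1 ∅ →* UForm P Q`**, `(g, h) ↦ (g ⊗ h)` relabelled by ★ `junE₁∕junE₂` (so `junctionMul (g, 1) = g`, `junctionMul_inl`), with
  **`toSp_junctionMul : toSp (junctionMul u) = reindexSp unitJunctionIdx (ι𝕎 P Q 1 ∅ u)`** (★ `UForm.toSp_relabel`);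
* §2 **`coe_proj_archWeilSectionS_placeSec_junction`** — `hs` in the junction frame `DPIdx P_σ Q_σ 1 ∅ ⊕ (Fin N × {v ≠ σ})`: along
  `placeSec σ ∘ junctionMul`, EVERY `u ∈ Ginf P_σ Q_σ 1 ∅` acts by `blockPhase ⇑(ι𝕎 P_σ Q_σ 1 ∅ u) id`;
* §3 the relabelled objects **`placeSecJ`** (`Ginf P′ Q′ 1 ∅ →* U(J)(F ⊗ ℝ)`), **`archSectionPhaseJ`**, **`archSectionRepJ`** (on `𝓢(ℝ^{DPIdx P′ Q′ 1 ∅ ⊕ …})`) and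
  their five facts `isArchWeilDatum_archSectionJ` (hW), `continuous_archSectionRepJ_apply` (hc), `continuous_placeSecJ` (hs_cont),
  **`coe_archSectionPhaseJ_placeSecJ`** (hs, ★ `coe_reindexSp_sumCongr_of_eq_blockPhase`);
* §4 **`exists_circle_twist_factorisation_placeSecJ`** — `∃ χ : Ginf P′ Q′ 1 ∅ →* 𝕊¹` continuous, `archSectionRepJ (placeSecJ u) (Φ₁ ⊠ Φ₂) =
  ((χ ⊗ weilRepPair) u Φ₁) ⊠ Φ₂` with the HYPOTHESIS-FREE junction datum ★ `weilRepPair = weilRep ∘ toBig` — literally the `hfac` of ★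
  `K2LiuWeilDatumTwistSmoothU22.contDiffAt_of_tensorPi_factorisation`; hence, for `P′ = Q′ = Fin 2` (the doubled group of #42F′ at any real place):
  **`contDiffAt_archSectionRepJ_placeSecJ`** — for every matrix-smooth `c : B → U(2,2)`, every continuous ℝ-linear `T` on the big Schwartz space and all
  `Φ₁, Φ₂`: `x ↦ T (archSectionRepJ (placeSecJ (c x, 1)) (Φ₁ ⊠ Φ₂))` is `C^∞` — FOLLAND'S SECTION OF THE WHOLE ARCHIMEDEAN GROUP IS SMOOTH ALONG `U(2,2)` AT `σ`
  ON PRODUCT VECTORS (engine: ★ `isArchWeilDatum_weilRepPair` + ★ `weilRepPair_κ_hermitePi_zero` + (G2-W2) + (G2-W4b)).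
What is NOT here (W4-ii, successor): `χ` pinned; the transport through ★ `omega_sD_archToAdelic_tmul` ∕ `carrierConjEquiv (scaledFrame …)` ∕ `piSchwartzBruhatEquiv`
to `swSection sD`, i.e. `hasDerivAt_swSection_arch_orbit`.

HONEST LABEL: HC_CM is proved only modulo the 7 printed citations (2 remaining named inputs: hLiu418 = stmt-HodgeConjecture-24832, h413 =
stmt-HodgeConjecture-24833) until rung 0 closes; organ capital for #42F′'s Road I, moves no counter.

## References
* [Weil1964] A. Weil, Acta Math. 111 (1964), Chap. I n° 12 p. 160, Chap. III n° 37–38.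
* [Folland1989] G. B. Folland, *Harmonic Analysis in Phase Space* (1989), Prop. (1.43), §4.2 (4.23)–(4.24), Prop. (4.39).
* [KonnoKonno2007] K. Konno, T. Konno, Kyushu J. Math. 61 (2007), §3.1 (3.1), §3.3, Lemma 5.2.
* [BorelJacquet1979] A. Borel, H. Jacquet, Proc. Symp. Pure Math. 33.1 (1979), §4.1.
-/

set_option autoImplicit false
set_option linter.dupNamespace false

noncomputable section

open scoped Matrix Classical Matrix.Norms.Operator
open MeasureTheory
open NumberField NumberField.InfinitePlace NumberField.mixedEmbedding
open Literature.NumberTheory.Automorphic Literature.NumberTheory.Automorphic.UnitaryGroup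
open Literature.RepresentationTheory.HeisenbergGroup Literature.Analysis.SegalBargmann
open Literature.RepresentationTheory.KonnoKonno2007 hiding LetterKind letterOf letterGen letterOf_boost letterOf_torus letterOf_torus_eq
  letterGen_boost letterGen_torus letterGen_mem_lie exp_smul_letterGen
open Literature.RepresentationTheory.KonnoKonno2007.RealDualPair
open Literature.NumberTheory.Weil1964 Literature.NumberTheory.Weil1964.MpS Literature.NumberTheory.Weil1964.UnitaryWeil
open Summit.HodgeConjecture.HodgeConjecture.Cruxes.HLiu418.K2LiuWeilDatumSmoothU22 (contDiffAt_of_tensorPi_factorisation)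

namespace Summit.HodgeConjecture.HodgeConjecture.Cruxes.HLiu418.K2LiuArchSectionPlaceBlock

/-! ## §1 The junction product `Ginf P Q 1 ∅ →* UForm P Q` -/

section JunctionMul

variable (P Q : Type) [Fintype P] [DecidableEq P] [Fintype Q] [DecidableEq Q]

/-- **`junctionMul P Q : Ginf P Q 1 ∅ →* UForm P Q`**, `(g, h) ↦ g ⊗ h` read back in `P ⊕ Q` through ★ `junE₁`, `junE₂` (★ `toBig`, ★ `UForm.relabel`):
the junction with the trivial partner `U(1,0)` as a homomorphism onto its first member. [cite: KonnoKonno2007, §3.1 (3.1)] -/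
def junctionMul : Ginf P Q Unit Empty →* UForm P Q :=
  (UForm.relabel ((P × Unit) ⊕ (Q × Empty)) ((P × Empty) ⊕ (Q × Unit)) P Q (junE₁ P Q).symm (junE₂ P Q).symm).toMulEquiv.toMonoidHom.comp
    (toBig P Q Unit Empty)

/-- Unfolding. [cite: KonnoKonno2007, §3.1 (3.1)] -/
theorem junctionMul_apply (u : Ginf P Q Unit Empty) :
    junctionMul P Q u =
      UForm.relabel ((P × Unit) ⊕ (Q × Empty)) ((P × Empty) ⊕ (Q × Unit)) P Q (junE₁ P Q).symm (junE₂ P Q).symm (toBig P Q Unit Empty u) := rfl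

/-- `junctionMul` is continuous. [cite: KonnoKonno2007, §3.1 (3.1)] -/
theorem continuous_junctionMul : Continuous (junctionMul P Q) :=
  (UForm.relabel ((P × Unit) ⊕ (Q × Empty)) ((P × Empty) ⊕ (Q × Unit)) P Q (junE₁ P Q).symm (junE₂ P Q).symm).continuous.comp continuous_toBig

/-- **on the first member `junctionMul (g, 1) = g`** (★ `toBig_inl_one`). [cite: KonnoKonno2007, §3.1 (3.1)] -/
theorem junctionMul_inl (g : UForm P Q) : junctionMul P Q (g, 1) = g := by
  rw [junctionMul_apply, toBig_inl_one]
  refine Subtype.ext (Units.ext ?_)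
  rw [UForm.coe_relabel, UForm.coe_relabel]
  ext i j
  simp only [Matrix.reindex_apply, Matrix.submatrix_apply, Equiv.sumCongr_symm, Equiv.symm_symm, Equiv.sumCongr_apply]
  rcases i with i | i <;> rcases j with j | j <;> simp only [Sum.map_inl, Sum.map_inr, Equiv.symm_apply_apply]

/-- **`toSp (junctionMul u) = reindexSp unitJunctionIdx (ι𝕎 P Q 1 ∅ u)`**: the phase map of the product is the junction's `ι𝕎 u` relabelled by ★
`unitJunctionIdx = junE₁ ⊕ junE₂` (★ `UForm.toSp_relabel`). [cite: KonnoKonno2007, §3.1 (3.1)] [cite: Weil1964, Chap. I n° 12 p. 160] -/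
theorem toSp_junctionMul (u : Ginf P Q Unit Empty) :
    UForm.toSp P Q (junctionMul P Q u) = reindexSp (unitJunctionIdx P Q) (ι𝕎 P Q Unit Empty u) := by
  rw [junctionMul_apply, UForm.toSp_relabel]
  rfl

end JunctionMul

/-! ## §2 `hs` in the junction frame at the canonical types -/

section Place

variable {F : Type} [Field F] [NumberField F] (E : Type) [Field E] [NumberField E] [Algebra F E] (c : E ≃ₐ[F] E)
  (N : ℕ) (hc : c ≠ 1)
  (wOf : {v : InfinitePlace F // v.IsReal} → {w : InfinitePlace E // w.IsComplex})
  (hw : ∀ v, c • (wOf v).1 = (wOf v).1) (t₀ : Fin N → F) (ht0 : ∀ j, t₀ j ≠ 0) {δ : E} (hcδ : c δ = -δ) (hδ : δ ≠ 0)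
  (σ : {v : InfinitePlace F // v.IsReal})
  (hover : ∀ v, (wOf v).1.comap (algebraMap F E) = v.1) {T : Matrix (Fin N) (Fin N) F} (hTd : T = Matrix.diagonal t₀)
  {J : Matrix (Fin N) (Fin N) E} (hJ : J = T.map (algebraMap F E)) (hfix : ∀ w : InfinitePlace E, c • w = w)

/-- **`hs` in the junction frame `DPIdx P_σ Q_σ 1 ∅ ⊕ (Fin N × {v ≠ σ})`**: along `placeSec σ ∘ junctionMul`, every `u ∈ Ginf P_σ Q_σ 1 ∅` acts by
`blockPhase ⇑(ι𝕎 P_σ Q_σ 1 ∅ u) id` ((W4-i) `coe_proj_archWeilSectionS_placeSec` + `toSp_junctionMul` + ★ `reindexPhase_sumCongr_blockPhase`).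
[cite: Weil1964, Chap. I n° 12 p. 160] [cite: KonnoKonno2007, §3.1 (3.1)] -/
theorem coe_proj_archWeilSectionS_placeSec_junction (u : Ginf (PosIdx (signVec wOf t₀ δ σ)) (NegIdx (signVec wOf t₀ δ σ)) Unit Empty) :
    (⇑((((reindexSp (Equiv.sumCongr (unitJunctionIdx (PosIdx (signVec wOf t₀ δ σ)) (NegIdx (signVec wOf t₀ δ σ))).symm
            (Equiv.refl (Fin N × {v : {v : InfinitePlace F // v.IsReal} // v ≠ σ})))).comp
          ((reindexSp (placeSplitEquiv (signSplit (signVec wOf t₀ δ σ)) σ)).comp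
            (MpS.proj.comp (archWeilSectionS E c N hc wOf hw hover t₀ ht0 hTd hJ hcδ hδ))))
          (placeSec E c N hc wOf hw t₀ ht0 hcδ hδ σ hover hTd hJ hfix
            (junctionMul (PosIdx (signVec wOf t₀ δ σ)) (NegIdx (signVec wOf t₀ δ σ)) u))).1 :
        (((DPIdx (PosIdx (signVec wOf t₀ δ σ)) (NegIdx (signVec wOf t₀ δ σ)) Unit Empty ⊕ (Fin N × {v : {v : InfinitePlace F // v.IsReal} // v ≠ σ})) → ℝ) ×
          ((DPIdx (PosIdx (signVec wOf t₀ δ σ)) (NegIdx (signVec wOf t₀ δ σ)) Unit Empty ⊕ (Fin N × {v : {v : InfinitePlace F // v.IsReal} // v ≠ σ})) → ℝ)) ≃ₗ[ℝ]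
        (((DPIdx (PosIdx (signVec wOf t₀ δ σ)) (NegIdx (signVec wOf t₀ δ σ)) Unit Empty ⊕ (Fin N × {v : {v : InfinitePlace F // v.IsReal} // v ≠ σ})) → ℝ) ×
          ((DPIdx (PosIdx (signVec wOf t₀ δ σ)) (NegIdx (signVec wOf t₀ δ σ)) Unit Empty ⊕ (Fin N × {v : {v : InfinitePlace F // v.IsReal} // v ≠ σ})) → ℝ))) :
        PhaseMap (DPIdx (PosIdx (signVec wOf t₀ δ σ)) (NegIdx (signVec wOf t₀ δ σ)) Unit Empty ⊕ (Fin N × {v : {v : InfinitePlace F // v.IsReal} // v ≠ σ}))) =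
      blockPhase
        (⇑((ι𝕎 (PosIdx (signVec wOf t₀ δ σ)) (NegIdx (signVec wOf t₀ δ σ)) Unit Empty u).1 :
          ((DPIdx (PosIdx (signVec wOf t₀ δ σ)) (NegIdx (signVec wOf t₀ δ σ)) Unit Empty → ℝ) ×
              (DPIdx (PosIdx (signVec wOf t₀ δ σ)) (NegIdx (signVec wOf t₀ δ σ)) Unit Empty → ℝ)) ≃ₗ[ℝ]
            ((DPIdx (PosIdx (signVec wOf t₀ δ σ)) (NegIdx (signVec wOf t₀ δ σ)) Unit Empty → ℝ) ×
              (DPIdx (PosIdx (signVec wOf t₀ δ σ)) (NegIdx (signVec wOf t₀ δ σ)) Unit Empty → ℝ))))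
        id := by
  rw [MonoidHom.comp_apply, coe_reindexSp, coe_proj_archWeilSectionS_placeSec, reindexPhase_sumCongr_blockPhase, reindexPhase_refl,
    toSp_junctionMul, coe_reindexSp, reindexPhase_reindexPhase, Equiv.symm_trans_self, reindexPhase_refl]

/-! ## §3 The relabelled block pair at literal block types `P′, Q′` -/

variable {P' Q' : Type} [Fintype P'] [DecidableEq P'] [Fintype Q'] [DecidableEq Q']
  (eP : PosIdx (signVec wOf t₀ δ σ) ≃ P') (eQ : NegIdx (signVec wOf t₀ δ σ) ≃ Q')

/-- **`placeSecJ : Ginf P′ Q′ 1 ∅ →* U(J)(F ⊗ ℝ)`** — the one-place section in junction currency at literal block types: relabel back by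
`(eP, eQ)`, multiply the junction, place at `σ` (`placeSec σ ∘ junctionMul ∘ (Ginf.relabel eP eQ)⁻¹`). [cite: BorelJacquet1979, §4.1] [cite: KonnoKonno2007, §3.1 (3.1)] -/
def placeSecJ : Ginf P' Q' Unit Empty →* UnitaryGroup.arch F E c N J :=
  (placeSec E c N hc wOf hw t₀ ht0 hcδ hδ σ hover hTd hJ hfix).comp
    ((junctionMul (PosIdx (signVec wOf t₀ δ σ)) (NegIdx (signVec wOf t₀ δ σ))).comp
      (Ginf.relabel (PosIdx (signVec wOf t₀ δ σ)) (NegIdx (signVec wOf t₀ δ σ)) Unit Empty P' Q' Unit Empty eP eQ (Equiv.refl Unit)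
          (Equiv.refl Empty)).symm.toMulEquiv.toMonoidHom)

/-- `placeSecJ` is continuous (`hs_cont`). [cite: BorelJacquet1979, §4.1] -/
theorem continuous_placeSecJ : Continuous (placeSecJ E c N hc wOf hw t₀ ht0 hcδ hδ σ hover hTd hJ hfix eP eQ) :=
  (continuous_placeSec E c N hc wOf hw t₀ ht0 hcδ hδ σ hover hTd hJ hfix).comp
    ((continuous_junctionMul _ _).comp
      (Ginf.relabel (PosIdx (signVec wOf t₀ δ σ)) (NegIdx (signVec wOf t₀ δ σ)) Unit Empty P' Q' Unit Empty eP eQ (Equiv.refl Unit)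
          (Equiv.refl Empty)).symm.continuous)

/-- **on the first member**: `placeSecJ (g, 1) = placeSec σ ((UForm.relabel eP eQ)⁻¹ g)` — the element with sign-frame component `g` (relabelled back) at `σ`,
`1` elsewhere. [cite: BorelJacquet1979, §4.1] -/
theorem placeSecJ_inl (g : UForm P' Q') :
    placeSecJ E c N hc wOf hw t₀ ht0 hcδ hδ σ hover hTd hJ hfix eP eQ (g, 1) =
      placeSec E c N hc wOf hw t₀ ht0 hcδ hδ σ hover hTd hJ hfix
        ((UForm.relabel (PosIdx (signVec wOf t₀ δ σ)) (NegIdx (signVec wOf t₀ δ σ)) P' Q' eP eQ).symm g) := by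
  show placeSec E c N hc wOf hw t₀ ht0 hcδ hδ σ hover hTd hJ hfix (junctionMul _ _
      ((Ginf.relabel (PosIdx (signVec wOf t₀ δ σ)) (NegIdx (signVec wOf t₀ δ σ)) Unit Empty P' Q' Unit Empty eP eQ (Equiv.refl Unit)
        (Equiv.refl Empty)).symm (g, 1))) = _
  have h1 : (Ginf.relabel (PosIdx (signVec wOf t₀ δ σ)) (NegIdx (signVec wOf t₀ δ σ)) Unit Empty P' Q' Unit Empty eP eQ (Equiv.refl Unit)
      (Equiv.refl Empty)).symm (g, 1) =
      ((UForm.relabel (PosIdx (signVec wOf t₀ δ σ)) (NegIdx (signVec wOf t₀ δ σ)) P' Q' eP eQ).symm g, 1) := by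
    rw [ContinuousMulEquiv.symm_apply_eq, Ginf.relabel_apply, ContinuousMulEquiv.apply_symm_apply, map_one]
  rw [h1, junctionMul_inl]

/-- **`ι𝕎′` in junction currency**: the phase homomorphism of `s_∞` read in the frame `DPIdx P′ Q′ 1 ∅ ⊕ (Fin N × {v ≠ σ})` (split at `σ`, junction relabelling,
block types relabelled). [cite: Weil1964, Chap. I n° 12 p. 160, Chap. III n° 37] -/
def archSectionPhaseJ :
    UnitaryGroup.arch F E c N J →*
      symplecticGroup (polar (dotPairing (DPIdx P' Q' Unit Empty ⊕ (Fin N × {v : {v : InfinitePlace F // v.IsReal} // v ≠ σ})))) :=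
  (reindexSp (Equiv.sumCongr
      (dpIdxCongr (PosIdx (signVec wOf t₀ δ σ)) (NegIdx (signVec wOf t₀ δ σ)) Unit Empty P' Q' Unit Empty eP eQ (Equiv.refl Unit)
        (Equiv.refl Empty)).symm
      (Equiv.refl (Fin N × {v : {v : InfinitePlace F // v.IsReal} // v ≠ σ})))).comp
    ((reindexSp (Equiv.sumCongr (unitJunctionIdx (PosIdx (signVec wOf t₀ δ σ)) (NegIdx (signVec wOf t₀ δ σ))).symm
        (Equiv.refl (Fin N × {v : {v : InfinitePlace F // v.IsReal} // v ≠ σ})))).comp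
      ((reindexSp (placeSplitEquiv (signSplit (signVec wOf t₀ δ σ)) σ)).comp
        (MpS.proj.comp (archWeilSectionS E c N hc wOf hw hover t₀ ht0 hTd hJ hcδ hδ))))

/-- **`ω′` in junction currency**: the operators of `s_∞` on `𝓢(ℝ^{DPIdx P′ Q′ 1 ∅ ⊕ (Fin N × {v ≠ σ})})`. [cite: Weil1964, Chap. III n° 37–38] [cite: Folland1989, §1.3 (1.25)] -/
def archSectionRepJ :
    Representation ℂ (UnitaryGroup.arch F E c N J)
      (SchwartzMap ((DPIdx P' Q' Unit Empty ⊕ (Fin N × {v : {v : InfinitePlace F // v.IsReal} // v ≠ σ})) → ℝ) ℂ) :=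
  repTransport (reindexCLE (Equiv.sumCongr
      (dpIdxCongr (PosIdx (signVec wOf t₀ δ σ)) (NegIdx (signVec wOf t₀ δ σ)) Unit Empty P' Q' Unit Empty eP eQ (Equiv.refl Unit)
        (Equiv.refl Empty)).symm
      (Equiv.refl (Fin N × {v : {v : InfinitePlace F // v.IsReal} // v ≠ σ}))))
    (repTransport (reindexCLE (Equiv.sumCongr (unitJunctionIdx (PosIdx (signVec wOf t₀ δ σ)) (NegIdx (signVec wOf t₀ δ σ))).symm
        (Equiv.refl (Fin N × {v : {v : InfinitePlace F // v.IsReal} // v ≠ σ}))))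
      (repTransport (reindexCLE (placeSplitEquiv (signSplit (signVec wOf t₀ δ σ)) σ))
        (MpS.toEnd.comp (archWeilSectionS E c N hc wOf hw hover t₀ ht0 hTd hJ hcδ hδ))))

omit [DecidableEq P'] [DecidableEq Q'] in
/-- **`hW` in junction currency** (★ `IsArchWeilDatum.reindex` three times over (W4-i) `isArchWeilDatum_archSection`).
[cite: Folland1989, §4.2 (4.23), Prop. (4.27)] [cite: Weil1964, Chap. I n° 12 p. 160] -/
theorem isArchWeilDatum_archSectionJ :
    IsArchWeilDatum (archSectionPhaseJ E c N hc wOf hw t₀ ht0 hcδ hδ σ hover hTd hJ eP eQ)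
      (archSectionRepJ E c N hc wOf hw t₀ ht0 hcδ hδ σ hover hTd hJ eP eQ) :=
  (((isArchWeilDatum_archSection E c N hc wOf hw t₀ ht0 hcδ hδ hover hTd hJ).reindex _).reindex _).reindex _

omit [DecidableEq P'] [DecidableEq Q'] in
/-- **`hc` in junction currency**: every operator of `archSectionRepJ` is continuous. [cite: Folland1989, §4.2 (4.23)] -/
theorem continuous_archSectionRepJ_apply (g : UnitaryGroup.arch F E c N J) :
    Continuous (archSectionRepJ E c N hc wOf hw t₀ ht0 hcδ hδ σ hover hTd hJ eP eQ g) :=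
  continuous_repTransport_reindexCLE _ (fun g => continuous_repTransport_reindexCLE _
    (fun g => continuous_repTransport_reindexCLE _
      (continuous_toEnd_comp_apply (archWeilSectionS E c N hc wOf hw hover t₀ ht0 hTd hJ hcδ hδ)) g) g) g

/-- **`hs` in junction currency — EVERY `u ∈ Ginf P′ Q′ 1 ∅` ACTS, ALONG `placeSecJ`, BY `blockPhase ⇑(ι𝕎 P′ Q′ 1 ∅ u) id`**
(§2 + ★ `coe_reindexSp_sumCongr_of_eq_blockPhase`). [cite: Weil1964, Chap. I n° 12 p. 160] [cite: KonnoKonno2007, §3.1 (3.1)] [cite: Folland1989, Prop. (1.43)] -/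
theorem coe_archSectionPhaseJ_placeSecJ (u : Ginf P' Q' Unit Empty) :
    (⇑((archSectionPhaseJ E c N hc wOf hw t₀ ht0 hcδ hδ σ hover hTd hJ eP eQ
          (placeSecJ E c N hc wOf hw t₀ ht0 hcδ hδ σ hover hTd hJ hfix eP eQ u)).1 :
        (((DPIdx P' Q' Unit Empty ⊕ (Fin N × {v : {v : InfinitePlace F // v.IsReal} // v ≠ σ})) → ℝ) ×
          ((DPIdx P' Q' Unit Empty ⊕ (Fin N × {v : {v : InfinitePlace F // v.IsReal} // v ≠ σ})) → ℝ)) ≃ₗ[ℝ]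
        (((DPIdx P' Q' Unit Empty ⊕ (Fin N × {v : {v : InfinitePlace F // v.IsReal} // v ≠ σ})) → ℝ) ×
          ((DPIdx P' Q' Unit Empty ⊕ (Fin N × {v : {v : InfinitePlace F // v.IsReal} // v ≠ σ})) → ℝ))) :
        PhaseMap (DPIdx P' Q' Unit Empty ⊕ (Fin N × {v : {v : InfinitePlace F // v.IsReal} // v ≠ σ}))) =
      blockPhase
        (⇑((ι𝕎 P' Q' Unit Empty u).1 :
          ((DPIdx P' Q' Unit Empty → ℝ) × (DPIdx P' Q' Unit Empty → ℝ)) ≃ₗ[ℝ] ((DPIdx P' Q' Unit Empty → ℝ) × (DPIdx P' Q' Unit Empty → ℝ))))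
        id := by
  -- the canonical-type pair element behind `u`
  have hu : Ginf.relabel (PosIdx (signVec wOf t₀ δ σ)) (NegIdx (signVec wOf t₀ δ σ)) Unit Empty P' Q' Unit Empty eP eQ (Equiv.refl Unit)
      (Equiv.refl Empty)
      ((Ginf.relabel (PosIdx (signVec wOf t₀ δ σ)) (NegIdx (signVec wOf t₀ δ σ)) Unit Empty P' Q' Unit Empty eP eQ (Equiv.refl Unit)
        (Equiv.refl Empty)).symm.toMulEquiv.toMonoidHom u) = u :=
    ContinuousMulEquiv.apply_symm_apply _ u
  have h₁ := coe_proj_archWeilSectionS_placeSec_junction E c N hc wOf hw t₀ ht0 hcδ hδ σ hover hTd hJ hfix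
    ((Ginf.relabel (PosIdx (signVec wOf t₀ δ σ)) (NegIdx (signVec wOf t₀ δ σ)) Unit Empty P' Q' Unit Empty eP eQ (Equiv.refl Unit)
        (Equiv.refl Empty)).symm.toMulEquiv.toMonoidHom u)
  have h₂ := coe_reindexSp_sumCongr_of_eq_blockPhase eP eQ (Equiv.refl Unit) (Equiv.refl Empty) _ _ h₁
  rw [hu] at h₂
  simpa only [archSectionPhaseJ, placeSecJ, MonoidHom.comp_apply] using h₂

/-! ## §4 The factorisation in junction currency, and smoothness along `U(2,2)` -/

/-- **THE ARCHIMEDEAN SECTION AT `σ` FACTORISES THROUGH THE JUNCTION WEIL REPRESENTATION**: there is a continuous character `χ : Ginf P′ Q′ 1 ∅ →* 𝕊¹`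
with `archSectionRepJ (placeSecJ u) (Φ₁ ⊠ Φ₂) = ((χ ⊗ (weilRep ∘ toBig)) u Φ₁) ⊠ Φ₂` for all `u, Φ₁, Φ₂` — the `hfac` of ★
`K2LiuWeilDatumTwistSmoothU22.contDiffAt_of_tensorPi_factorisation`, with the hypothesis-free small datum ★ `isArchWeilDatum_weilRepPair`.
[cite: Folland1989, Prop. (1.43), §4.2 (4.23)] [cite: Weil1964, Chap. III n° 37–38] [cite: KonnoKonno2007, §3.3] -/
theorem exists_circle_twist_factorisation_placeSecJ :
    ∃ χ : Ginf P' Q' Unit Empty →* Circle, Continuous χ ∧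
      ∀ (u : Ginf P' Q' Unit Empty) (Φ₁ : SchwartzMap (DPIdx P' Q' Unit Empty → ℝ) ℂ)
        (Φ₂ : SchwartzMap ((Fin N × {v : {v : InfinitePlace F // v.IsReal} // v ≠ σ}) → ℝ) ℂ),
        archSectionRepJ E c N hc wOf hw t₀ ht0 hcδ hδ σ hover hTd hJ eP eQ
            (placeSecJ E c N hc wOf hw t₀ ht0 hcδ hδ σ hover hTd hJ hfix eP eQ u) (tensorPi Φ₁ Φ₂) =
          tensorPi (charTwist (Circle.coeHom.comp χ)
            ((weilRep (α := (P' × Unit) ⊕ (Q' × Empty)) (β := (P' × Empty) ⊕ (Q' × Unit))).comp (toBig P' Q' Unit Empty)) u Φ₁) Φ₂ :=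
  (isArchWeilDatum_archSectionJ E c N hc wOf hw t₀ ht0 hcδ hδ σ hover hTd hJ eP eQ).exists_circle_twist_factorisation
    (continuous_archSectionRepJ_apply E c N hc wOf hw t₀ ht0 hcδ hδ σ hover hTd hJ eP eQ)
    (isArchWeilDatum_weilRepPair P' Q' Unit Empty) (fun u => (weilElt (toBig P' Q' Unit Empty u)).1.2.continuous)
    (placeSecJ E c N hc wOf hw t₀ ht0 hcδ hδ σ hover hTd hJ hfix eP eQ) (continuous_placeSecJ E c N hc wOf hw t₀ ht0 hcδ hδ σ hover hTd hJ hfix eP eQ)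
    (coe_archSectionPhaseJ_placeSecJ E c N hc wOf hw t₀ ht0 hcδ hδ σ hover hTd hJ hfix eP eQ)

/-- **FOLLAND'S SECTION OF THE WHOLE ARCHIMEDEAN GROUP IS `C^∞` ALONG `U(2,2)` AT `σ` ON PRODUCT VECTORS**: for a real place `σ` at which the sign frame has
types `P_σ ≃ Fin 2`, `Q_σ ≃ Fin 2` (the doubled group `U(hermD)` of #42F′ at every real place), every matrix-smooth `c : B → U(2,2)`, every continuous ℝ-linear
`T` on `𝓢(ℝ^{DPIdx (Fin 2) (Fin 2) 1 ∅ ⊕ (Fin N × {v ≠ σ})})` and all `Φ₁, Φ₂`: `x ↦ T (archSectionRepJ (placeSecJ (c x, 1)) (Φ₁ ⊠ Φ₂))` is `C^∞`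
(§4 factorisation + ★ (G2-W4b) `contDiffAt_of_tensorPi_factorisation` over ★ `isArchWeilDatum_weilRepPair` + ★ `weilRepPair_κ_hermitePi_zero`).
[cite: Folland1989, Prop. (1.43), §4.2 (4.23)–(4.24), Prop. (4.39)] [cite: KonnoKonno2007, §3.3, Lemma 5.2] -/
theorem contDiffAt_archSectionRepJ_placeSecJ (e₂P : PosIdx (signVec wOf t₀ δ σ) ≃ Fin 2) (e₂Q : NegIdx (signVec wOf t₀ δ σ) ≃ Fin 2)
    {B : Type*} [NormedAddCommGroup B] [NormedSpace ℝ B] {c' : B → UForm (Fin 2) (Fin 2)} {x₀ : B}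
    (hc' : ContDiffAt ℝ ((⊤ : ℕ∞) : WithTop ℕ∞) (fun x => ((c' x : GL (Fin 2 ⊕ Fin 2) ℂ) : Matrix (Fin 2 ⊕ Fin 2) (Fin 2 ⊕ Fin 2) ℂ)) x₀)
    {V : Type*} [NormedAddCommGroup V] [NormedSpace ℝ V]
    (T' : (SchwartzMap ((DPIdx (Fin 2) (Fin 2) Unit Empty ⊕ (Fin N × {v : {v : InfinitePlace F // v.IsReal} // v ≠ σ})) → ℝ) ℂ) →L[ℝ] V)
    (Φ₁ : SchwartzMap (DPIdx (Fin 2) (Fin 2) Unit Empty → ℝ) ℂ) (Φ₂ : SchwartzMap ((Fin N × {v : {v : InfinitePlace F // v.IsReal} // v ≠ σ}) → ℝ) ℂ) :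
    ContDiffAt ℝ ((⊤ : ℕ∞) : WithTop ℕ∞)
      (fun x => T' (archSectionRepJ E c N hc wOf hw t₀ ht0 hcδ hδ σ hover hTd hJ e₂P e₂Q
        (placeSecJ E c N hc wOf hw t₀ ht0 hcδ hδ σ hover hTd hJ hfix e₂P e₂Q ((c' x, (1 : UForm Unit Empty)) : Ginf (Fin 2) (Fin 2) Unit Empty))
        (tensorPi Φ₁ Φ₂))) x₀ := by
  obtain ⟨χ, hχ, hfac⟩ := exists_circle_twist_factorisation_placeSecJ E c N hc wOf hw t₀ ht0 hcδ hδ σ hover hTd hJ hfix e₂P e₂Q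
  exact contDiffAt_of_tensorPi_factorisation _ _ (isArchWeilDatum_weilRepPair (Fin 2) (Fin 2) Unit Empty) weilRepPair_κ_hermitePi_zero hχ Φ₂
    (fun u Φ => hfac u Φ Φ₂) hc' T' Φ₁

end Place

end Summit.HodgeConjecture.HodgeConjecture.Cruxes.HLiu418.K2LiuArchSectionPlaceBlock

end
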